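import Summits.BirchSwinnertonDyer.Rank1Residual.TwoVariableOrdinaryMainConjecture
import Literature.NumberTheory.EllipticCurves.BurungaleCastellaSkinner2025.GreenbergMuInvariantProofs
import HarnessLib

/-!
# The GREENBERG two-variable Iwasawa main conjecture for `E/K` over the `ℤ_p²`-extension
# ("`(L_p^Gr(E/K)) = ch_{Λ_K}(X_Gr(E/K_∞))` in `Λ_K^ur`"; Burungale–Castella–Skinner 2025, statement
# 4.1.2 = Yan–Zhu 2026, statement 4.1 (2)) — TYPED as an obligation leaf (`@[conjecture]`, nothing
# asserted) in the SOUND, reduction-type-free value frame `IsGreenbergLFunctionAnyRoot₂` (v2), with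
# BCS Thm. 4.1.3 ("4.1.1 ⟺ 4.1.2") as PROVED edges modulo the typed Beilinson–Flach equivalence

STAGED by the cross-ladder literature-typing layer (cell `bsd-littype`, seat 03, gen 4, v2; D-0088(4);
sheet `staging/bsd-littype-03/SHEETS-03.md` §7).  Companion of `TwoVariableOrdinaryMainConjecture.lean`
(same directory, gen 3: the ORDINARY statement 4.1.1 as `OrdinaryTwoVariableMainConjectureAt`, which
recorded 4.1.2 as "NOT typed: no carrier for `L_p^Gr`").  A carrier now exists: the value frame
`IsGreenbergLFunctionAnyRoot₂` (`BurungaleSkinnerTianWan2024/GreenbergMainStatementOPEN.lean`: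
`𝓛_p^Gr := h_K·𝓛_𝔭(K)'·𝓛_p^II`, [CGS25, Def. 2.4.3] = [YZ26, Def. 3.11], receptacle `𝒪_{ℂ_p}⟦T₁⟧⟦T₂⟧`,
Katz frame at the INVERSE generators — (O1)–(O4) of `Rubin1991/TwoVariableMainConjecture.lean` —,
`L`-value through an entire continuation, type-II Euler factor at ANY root of `x² − a_p x + p`:
reduction-type-free, so print's "good reduction" is typable) with the named facts of
`YanZhu2026/GreenbergMainTheoremsAnyRoot.lean`: `thm42_XGr₂_isTorsion_charIdeal_le_greenbergAnyRoot`
(Thm. 4.2 (2) + (Im): proves 4.1 (2) on a locus) and `thm47_ord_localised_iff_greenbergAnyRoot_localised`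
(Thm. 4.7 = BCS Thm. 4.1.3 = [BSTW, Prop. 9.18]).  This file files statement 4.1.2 in that currency and
PROVES BCS's "In particular, Conjecture 4.1.1 and Conjecture 4.1.2 are equivalent" modulo the typed
equivalence fact.  Conjectures are not Literature (CONVENTIONS §4), hence a Summits leaf; HONEST
FRAMING (cell): "typed ≠ proved ≠ endorsed".

## Relation to `TwoVariableGreenbergMainConjecture.lean` (same seat, v1, p483213) — ERRATUM
That file typed the same two statements (`GreenbergTwoVariableMainConjectureAt`,
`bcs2025_statement_4_1_2`) over `YanZhu2026.IsGreenbergLFunction₂`, which reads `L(f/K, ξ, 1)` through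
`rankinSelbergValueHecke` — junk `0` on the non-unitary half `n > m` of the type-II range
(`RankinSelbergValueHeckeVacuityProofs.lean`; seat `bsd-littype-02`, cell INBOX 2026-08-27T01:24:27Z):
no series satisfies that frame, so those `∃ G`-statements are unsatisfiable AS TYPED (an artefact, not
print) and their edges vacuous.  Summits theorem files are append-only, so the corrected typing lives
HERE under the `…AnyRoot` names (this file SUPERSEDES that one): definitions over
`IsGreenbergLFunctionAnyRoot₂`, the sentence with print's hypotheses UNBUNDLED (good reduction, (spl);
no ordinarity / `(N, D_K) = 1` / (disc)), every edge over the superseding `…AnyRoot` facts of [YZ26].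

## The printed statements

A. Burungale, F. Castella, C. Skinner, *Base change and Iwasawa main conjectures for GL₂*, IMRN 2025
rnaf082 = arXiv:2405.00270v2, §4.1, p. 8 (`[corpus: paper:arxiv-2405.00270 p0008 L15–L51]`):

> **4.1.2.** Let `g ∈ S₂(Γ₀(N))` be a newform and `p > 2` a prime of good reduction for `g`. Let
> `K` be an imaginary quadratic field satisfying (spl). Then `X_Gr(g/K_∞)` is `Λ_K`-torsion, with
> `(L_p^Gr(g/K)) = ch_{Λ_K}(X_Gr(g/K_∞))` as ideals in `Λ_K^ur`.
> **Theorem 4.1.3.** Let `g ∈ S₂(Γ₀(N))` be an elliptic newform, and `p ∤ 2N` an ordinary prime for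
> `g`. Let `K` be an imaginary quadratic field satisfying (spl), `(D_K, N) = 1`, and (irr_K). Then the
> following are equivalent: (i) `X_ord(g/K_∞)` is `Λ_K`-torsion, with
> `(L_p^PR(g/K)) ⊃ ch_{Λ_K}(X_ord(g/K_∞))` in `Λ_K ⊗ ℚ_p`. (ii) `X_Gr(g/K_∞)` is `Λ_K`-torsion, with
> `(L_p^Gr(g/K)) ⊃ ch_{Λ_K}(X_Gr(g/K_∞))` in `Λ_K^ur ⊗ ℚ_p`.
> The same conclusion holds for the opposite divisibilities, and before inverting `p`. In particular,
> Conjecture 4.1.1 and Conjecture 4.1.2 are equivalent.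
> *Proof.* This is shown in [BSTW23, §9.3.2] (cf. [CGS23, Prop. 3.2.1] or [Cas24, §3.3]) building on
> a pair of four-term exact sequences coming from Poitou–Tate duality. □

with (p. 7, `[p0007 L52–L60]`) the standing assumption of §4 "(irr_K): `ρ̄_g` is irreducible as
`G_K`-representation, where `K = M` is imaginary quadratic in this section" and "We refer the reader
to §§1.2 and 1.4 of [CGS23] for … `L_p^Gr(g/K) ∈ Λ_K^ur`".  X. Yan, X. Zhu, J. Algebra **693** (2026)
= arXiv:2412.20078v4, §4.1 statement 4.1 (2) (l.923–927): "`𝒳_{𝓕_Gr}(E/K_∞)` is `Λ_K`-torsion and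
`Char_{Λ_K}(𝒳_{𝓕_Gr}(E/K_∞))Λ_K^ur = (𝓛_p^Gr(E/K))`"; Thm. 4.2 (2) + (Im) (l.932–949) proves it under
the Heegner hypothesis and absolute irreducibility; Thm. 4.7 (l.1022–1034) is the `S`-localised
equivalence of the ORDINARY and GREENBERG divisibilities in both directions.  STATUS IN PRINT: OPEN as
printed outside those loci (no Heegner hypothesis; (irr_K) without (Im); supersingular `p`).

## Transcription (tree vocabulary only; every carrier cited by name, none re-declared)

That of `YanZhu2026.thm42_XGr₂_…AnyRoot` ((T1)–(T8), (D1)–(D2) there): `E = W/ℚ` globally minimal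
with newform `f`; `(p) = v v̄` in `K`, `v` induced by `ι`; `Γ_K` through (cyc, anti) `(κ₁, κ₂)` with
adapted generators `(γ₁, γ₂)`, `Λ_K = IwasawaAlgebra₂ p`; `X_Gr(E/K_∞) = (W.baseChange K).XGr₂ p κ₁ κ₂ v̄ γ₁ γ₂`;
`L_p^Gr(E/K) = G` characterised by `IsGreenbergLFunctionAnyRoot₂ ι v v̄ κ₁ κ₂ γ₁⁻¹ γ₂⁻¹ f |D_K| h_K LK G`
over a Katz frame `LK`; "`Char(X)Λ_K^ur = (𝓛)`" = equality of `charIdeal.map (toUnr₂ p J)` with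
`span {G}` along every structure-compatible `J : ℤ_p → 𝒪_{ℂ_p}`.  The sentence `bcs2025_statement_4_1_2_anyRoot`
carries print's hypotheses unbundled — `N = N_E`, `p > 2` of GOOD reduction (`Rank1Residual.Good`),
`K` imaginary quadratic, (spl) `(p) = v v̄` with `v̄ ≠ v` and `v` induced by `ι`, `(κ₁, κ₂)` = (cyc,
anti) (the coordinates of the carriers) — and §4's standing (irr_K); `E`-case (WEAKER: special case of
"newform `g`").  The edges (1), (3) live on the locus of the [YZ26] facts (`YanZhu2026.GreenbergSetting`:
good ORDINARY, `(N, D_K) = 1`, (disc)).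
-- TODO(general form): newforms `g ∈ S₂(Γ₀(N))` with arbitrary coefficient field (needs `X_Gr(g/K_∞)` over `𝒪_λ⟦Γ_K⟧`).

## What this file declares

* `GreenbergTwoVariableMainConjectureAnyRootAt ι W K v v̄ κ₁ κ₂ γ₁ γ₂ f` — the statement AT a datum (literally
  the (Im)-conclusion shape of `thm42_XGr₂_…AnyRoot`); `bcs2025_statement_4_1_2_anyRoot` — the printed sentence.
  Both `@[conjecture]`; nothing asserted.
* PROVED edges (kernel bookkeeping): (1) `of_yanZhu_thm42_of_bigIm` (YZ Thm. 4.2 (2) + (Im) ⟹ the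
  statement at a datum); (2) `isTorsion`, `charIdeal_map_eq_span`, `exists_frame_hasUnitContent_minus`
  (with the PROVED `μ`-transfer `hasUnitContent_minus_of_prop314AnyRoot_of_prop422` of
  `GreenbergMuInvariantProofs.lean` §D: BCS Prop. 4.2.2); (3) **BCS Thm. 4.1.3 modulo
  `YanZhu2026.thm47_…AnyRoot_…`**: `charIdeal_map_eq_span_of_ordinaryAt`,
  `ordinary_inclusions_of_greenbergAt`, `of_ordinaryAt`, `ordinaryAt_of` (the `X_ord`-torsion clause
  discharged by the flag-free `YanZhu2026.cor29_XOrd₂_isTorsion`) — Thm. 4.7 AS TYPED transports the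
  divisibilities, not the torsion-ness of `X_Gr`, which is therefore a hypothesis of `of_ordinaryAt`
  (the `iff` packaging is left to the reader: `⟨of_ordinaryAt …, ordinaryAt_of …⟩`); (4) `at_of_statement`, `at_of_statement_of_greenbergSetting`.  (A
  compatible `J` EXISTS — `exists_structureMap_padicInt` — so the "`∀ J`" clauses are not vacuous.)
Consumers: two-variable cells (BSTW §9–10; LADDER-BSD K3/D1); `--conditional-on` leaf (any good `p`).

## References
* [BurungaleCastellaSkinner2025] IMRN 2025 rnaf082 = arXiv:2405.00270v2: §4.1 statements 4.1.1/4.1.2,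
  Thm. 4.1.3, Cor. 4.1.4 (p. 8); §4 standing (irr_K) (p. 7); Prop. 4.2.2 (p. 9).
* [YanZhu2024MainConjNonCM] J. Algebra 693 (2026) = arXiv:2412.20078v4: statement 4.1 (2) (l.923–927),
  Thm. 4.2 (2) (l.932–949), Thm. 4.7 (l.1022–1034), Def. 3.11, Cor. 2.9.
* [CastellaGrossiSkinner2025] Math. Ann. 393 (2025): Def. 2.4.3 (`L_p^Gr`), Prop. 4.2.1.
* [BurungaleSkinnerTianWan2024] arXiv:2409.01350, §1.2.1 (`𝓛_p^Gr` "independent of the type of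
  reduction"), §9.3.2 / Prop. 9.18 (the printed proof of Thm. 4.1.3).
-/

noncomputable section

open scoped Classical

open PowerSeries NumberField IsDedekindDomain Field CongruenceSubgroup
  Literature.NumberTheory.GaloisRepresentations Literature.NumberTheory.EllipticCurves
  Literature.NumberTheory.EllipticCurves.ModularForms Literature.NumberTheory.EllipticCurves.Rank1Residual
  Literature.NumberTheory.EllipticCurves.IwasawaAlgebra₂ Literature.NumberTheory.EllipticCurves.UnrSeries₂
  Literature.NumberTheory.EllipticCurves.GreenbergVatsal2000
  Literature.NumberTheory.EllipticCurves.BurungaleCastellaSkinner2025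
  Literature.NumberTheory.EllipticCurves.YanZhu2026

namespace Summit.BirchSwinnertonDyer.Rank1Residual.TwoVariableIMC

/-- **The Greenberg two-variable main conjecture AT a datum — TYPED** (Burungale–Castella–Skinner
2025 statement 4.1.2 = Yan–Zhu 2026 statement 4.1 (2), `E`-case): for `E = W/ℚ` with newform `f`,
the field `K` with `(p) = v v̄`, `Γ_K` through `(κ₁, κ₂; γ₁, γ₂)` and an embedding datum `ι`: "there
are Katz–de Shalit period data `(Ω ≠ 0, δ² = ±D_K, Ω_p ∈ R₀ˣ)`, a series `LK` which IS `𝓛_𝔭(K)`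
(`IsKatzMeasure₂ …` at `(γ₁⁻¹, γ₂⁻¹)`) and a series `G` which IS `L_p^Gr(E/K)`
(`IsGreenbergLFunctionAnyRoot₂`: the sound, reduction-type-free value frame), such that
`X = X_Gr(E/K_∞) = XGr₂ … v̄` is `Λ_K`-torsion and `ch_{Λ_K}(X)·Λ_K^ur = (L_p^Gr(E/K))`" (equality of
the extended ideal with `(G)` along every structure-compatible `J : ℤ_p → 𝒪_{ℂ_p}`).  The
(Im)-conclusion shape of [YZ26, Thm. 4.2 (2)].  A predicate; nothing asserted; OPEN in general (known
in print on the Heegner / big-image locus at ordinary `p`, [YZ26, Thm. 4.2 (2)]).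
[cite: BurungaleCastellaSkinner2025, statement 4.1.2 (§4.1, p. 8 of arXiv:2405.00270v2) with §4 standing hypotheses (p. 7)]
[cite: YanZhu2024MainConjNonCM, statement 4.1 (2) (arXiv:2412.20078v4 TeX l.923–927) with Def. 3.11 (l.865–871)] -/
@[conjecture] def GreenbergTwoVariableMainConjectureAnyRootAt {p : ℕ} [Fact p.Prime] (ι : PadicAlgCl p ≃+* ℂ)
    (W : WeierstrassCurve ℚ) [W.IsElliptic] [W.IsGloballyMinimal] (K : Type) [Field K] [NumberField K]
    (v vbar : HeightOneSpectrum (𝓞 K)) (κ₁ κ₂ : ZpExtension K p) (γ₁ γ₂ : absoluteGaloisGroup K)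
    [Fact (ZpExtension.IsTopGeneratorPair κ₁ κ₂ γ₁ γ₂)] {N : ℕ} [NeZero N]
    (f : CuspForm (Gamma0 N) 2) [NeZero (NumberField.discr K).natAbs] : Prop :=
  ∃ (Ω δ : ℂ) (Ωp : (unrIntegers p)ˣ) (LK G : PowerSeries (PowerSeries (PadicComplexInt p))),
    Ω ≠ 0 ∧ (δ ^ 2 = (NumberField.discr K : ℂ) ∨ δ ^ 2 = -(NumberField.discr K : ℂ)) ∧
    IsKatzMeasure₂ ι v vbar ∅ κ₁ κ₂ γ₁⁻¹ γ₂⁻¹ 1 Ω δ ((Ωp : unrIntegers p) : ℂ_[p]) LK ∧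
    IsGreenbergLFunctionAnyRoot₂ ι v vbar κ₁ κ₂ γ₁⁻¹ γ₂⁻¹ f (NumberField.discr K).natAbs
      (NumberField.classNumber K) LK G ∧
    Module.IsTorsion (IwasawaAlgebra₂ p) ((W.baseChange K).XGr₂ p κ₁ κ₂ vbar γ₁ γ₂) ∧
    ∀ J : ℤ_[p] →+* PadicComplexInt p,
      (∀ x : ℤ_[p], ((J x : PadicComplexInt p) : ℂ_[p]) = ((x : ℚ_[p]) : ℂ_[p])) →
      (WeierstrassCurve.XGr₂.charIdeal (W.baseChange K) p κ₁ κ₂ vbar γ₁ γ₂).map (toUnr₂ p J) =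
        Ideal.span {G}

/-- **Burungale–Castella–Skinner 2025, statement 4.1.2 (§4.1, p. 8), `E`-case, verbatim**: "Let
`g ∈ S₂(Γ₀(N))` be a newform and `p > 2` a prime of good reduction for `g`. Let `K` be an imaginary
quadratic field satisfying (spl). Then `X_Gr(g/K_∞)` is `Λ_K`-torsion, with
`(L_p^Gr(g/K)) = ch_{Λ_K}(X_Gr(g/K_∞))` as ideals in `Λ_K^ur`."  Transcribed for `g = f_E` (`E = W`
globally minimal of conductor `N`) with print's hypotheses unbundled: `p > 2` of GOOD reduction
(`Rank1Residual.Good W p` — ordinary or supersingular), `K` imaginary quadratic, (spl): `(p) = v v̄`,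
`v̄ ≠ v`, `v` the prime induced by `ι` (the embedding-compatibility clause of the carriers), and the
coordinates `(κ₁, κ₂)` = (cyclotomic, anticyclotomic) of the carriers; plus §4's standing (irr_K)
(p. 7).  `E`-case: WEAKER than print (special case of "newform `g`").  A statement STATED, and proved
on a locus, by the source; nothing asserted here.
-- TODO(general form): arbitrary newforms `g ∈ S₂(Γ₀(N))`.
[cite: BurungaleCastellaSkinner2025, statement 4.1.2 (§4.1, p. 8 of arXiv:2405.00270v2) with (irr_K) (p. 7)]
[cite: YanZhu2024MainConjNonCM, statement 4.1 (2) (arXiv:2412.20078v4 TeX l.923–927) with §4.1 setting (l.909–915)] -/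
@[conjecture] def bcs2025_statement_4_1_2_anyRoot : Prop :=
  ∀ {p : ℕ} [Fact p.Prime] (ι : PadicAlgCl p ≃+* ℂ) (W : WeierstrassCurve ℚ) [W.IsElliptic]
    [W.IsGloballyMinimal] (K : Type) [Field K] [NumberField K] (v vbar : HeightOneSpectrum (𝓞 K))
    (κ₁ κ₂ : ZpExtension K p) (γ₁ γ₂ : absoluteGaloisGroup K)
    [Fact (ZpExtension.IsTopGeneratorPair κ₁ κ₂ γ₁ γ₂)] {N : ℕ} [NeZero N] {f : CuspForm (Gamma0 N) 2}
    (_ : IsNewformOf W f) [NeZero (NumberField.discr K).natAbs],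
    (N : ℤ) = W.conductorNorm ℤ → 3 ≤ p → Good W p → IsImaginaryQuadratic K →
    ((Ideal.span {(p : ℤ)}).primesOver (𝓞 K)).ncard = 2 →
    ((p : ℕ) : 𝓞 K) ∈ v.asIdeal → ((p : ℕ) : 𝓞 K) ∈ vbar.asIdeal → vbar ≠ v →
    (∀ (w : InfinitePlace K) (k : 𝓞 K), k ∈ v.asIdeal ↔ ‖ι.symm (w.embedding (k : K))‖ < 1) →
    κ₁.IsCyclotomic → κ₂.IsAnticyclotomic → (W.baseChange K).HasIrreducibleModPGaloisRep p →
    GreenbergTwoVariableMainConjectureAnyRootAt ι W K v vbar κ₁ κ₂ γ₁ γ₂ f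

namespace GreenbergAnyRoot

variable {p : ℕ} [Fact p.Prime] {K : Type} [Field K] [NumberField K]

/-! ### (1) Yan–Zhu Thm. 4.2 (2) + (Im) ⟹ the statement at `(E, K, p)` — PROVED -/

/-- **Yan–Zhu 2026 Thm. 4.2 (2) with its (Im) clause gives statement 4.1.2 at `(E, K, p)`** on its
locus: the Greenberg standing data, Heegner hypothesis, `ρ̄_E|_{G_K}` absolutely irreducible, and
(Im) (`BigIm W p`). [cite: YanZhu2024MainConjNonCM, Thm. 4.2 (2) and the (Im) clause (arXiv:2412.20078v4 TeX l.932–949)]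
[cite: BurungaleCastellaSkinner2025, statement 4.1.2 (§4.1, p. 8 of arXiv:2405.00270v2)] -/
theorem of_yanZhu_thm42_of_bigIm (h : thm42_XGr₂_isTorsion_charIdeal_le_greenbergAnyRoot)
    (ι : PadicAlgCl p ≃+* ℂ) (W : WeierstrassCurve ℚ) [W.IsElliptic] [W.IsGloballyMinimal]
    (v vbar : HeightOneSpectrum (𝓞 K)) (κ₁ κ₂ : ZpExtension K p) (γ₁ γ₂ : absoluteGaloisGroup K)
    [Fact (ZpExtension.IsTopGeneratorPair κ₁ κ₂ γ₁ γ₂)] {N : ℕ} [NeZero N]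
    {f : CuspForm (Gamma0 N) 2} (hf : IsNewformOf W f) [NeZero (NumberField.discr K).natAbs]
    (hS : GreenbergSetting ι W N K v vbar κ₁ κ₂) (hHeeg : SatisfiesHeegnerHypothesis N K)
    (habs : ∀ ρ : ModPGaloisRep K (ZMod p) 2, (W.baseChange K).IsTorsionGaloisRep p ρ →
      FramedRep.IsAbsolutelyIrreducible ρ) (hIm : BigIm W p) :
    GreenbergTwoVariableMainConjectureAnyRootAt ι W K v vbar κ₁ κ₂ γ₁ γ₂ f := by
  obtain ⟨Ω, δ, Ωp, LK, G, hΩ, hδ, hLK, hG, htor, hJ⟩ := h ι W K v vbar κ₁ κ₂ γ₁ γ₂ hf hS hHeeg habs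
  exact ⟨Ω, δ, Ωp, LK, G, hΩ, hδ, hLK, hG, htor, fun J hJc ↦ (hJ J hJc).2 hIm⟩

/-! ### (2) Consequences AT a datum — PROVED -/

section Consequences

variable {ι : PadicAlgCl p ≃+* ℂ} {W : WeierstrassCurve ℚ} [W.IsElliptic] [W.IsGloballyMinimal]
  {v vbar : HeightOneSpectrum (𝓞 K)} {κ₁ κ₂ : ZpExtension K p} {γ₁ γ₂ : absoluteGaloisGroup K}
  [Fact (ZpExtension.IsTopGeneratorPair κ₁ κ₂ γ₁ γ₂)] {N : ℕ} [NeZero N] {f : CuspForm (Gamma0 N) 2}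
  [NeZero (NumberField.discr K).natAbs]

/-- The statement at a datum gives: `X_Gr(E/K_∞)` is `Λ_K`-torsion.
[cite: BurungaleCastellaSkinner2025, statement 4.1.2 (torsion clause, p. 8 of arXiv:2405.00270v2)] -/
theorem isTorsion (h : GreenbergTwoVariableMainConjectureAnyRootAt ι W K v vbar κ₁ κ₂ γ₁ γ₂ f) :
    Module.IsTorsion (IwasawaAlgebra₂ p) ((W.baseChange K).XGr₂ p κ₁ κ₂ vbar γ₁ γ₂) := by
  obtain ⟨-, -, -, -, -, -, -, -, -, htor, -⟩ := h
  exact htor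

/-- The statement at a datum gives the equality `ch(X_Gr)·𝒪_{ℂ_p}⟦T₁,T₂⟧ = (L_p^Gr)` for SOME
Katz/Greenberg frame and EVERY compatible structure map.
[cite: BurungaleCastellaSkinner2025, statement 4.1.2 (p. 8 of arXiv:2405.00270v2)]
[cite: YanZhu2024MainConjNonCM, statement 4.1 (2) (arXiv:2412.20078v4 TeX l.923–927)] -/
theorem charIdeal_map_eq_span (h : GreenbergTwoVariableMainConjectureAnyRootAt ι W K v vbar κ₁ κ₂ γ₁ γ₂ f) :
    ∃ (Ω δ : ℂ) (Ωp : (unrIntegers p)ˣ) (LK G : PowerSeries (PowerSeries (PadicComplexInt p))),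
      IsKatzMeasure₂ ι v vbar ∅ κ₁ κ₂ γ₁⁻¹ γ₂⁻¹ 1 Ω δ ((Ωp : unrIntegers p) : ℂ_[p]) LK ∧
      IsGreenbergLFunctionAnyRoot₂ ι v vbar κ₁ κ₂ γ₁⁻¹ γ₂⁻¹ f (NumberField.discr K).natAbs
        (NumberField.classNumber K) LK G ∧
      ∀ J : ℤ_[p] →+* PadicComplexInt p,
        (∀ x : ℤ_[p], ((J x : PadicComplexInt p) : ℂ_[p]) = ((x : ℚ_[p]) : ℂ_[p])) →
        (WeierstrassCurve.XGr₂.charIdeal (W.baseChange K) p κ₁ κ₂ vbar γ₁ γ₂).map (toUnr₂ p J) =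
          Ideal.span {G} := by
  obtain ⟨Ω, δ, Ωp, LK, G, -, -, hLK, hG, -, hJ⟩ := h
  exact ⟨Ω, δ, Ωp, LK, G, hLK, hG, hJ⟩

/-- **`μ(L_p^Gr) = 0` for the conjecture's own frame** (BCS Prop. 4.2.2, `L_p^Gr` half, through the
PROVED transfer `hasUnitContent_minus_of_prop314AnyRoot_of_prop422` of `GreenbergMuInvariantProofs.lean`
§D): granted the comparison fact `prop314_…_anyRoot` and the BDP half `prop422_…`, under the Greenberg standing
data, (Heeg) and (irr_K), the statement at a datum yields a frame `(LK, G)` for which BOTH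
`ch(X_Gr)·𝒪_{ℂ_p}⟦T₁,T₂⟧ = (G)` AND `μ(G⁻) = 0` (some coefficient of `G(0,T₂)` is a unit).
[cite: BurungaleCastellaSkinner2025, Prop. 4.2.2 and statement 4.1.2 (pp. 8–9 of arXiv:2405.00270v2)] -/
theorem exists_frame_hasUnitContent_minus (h : GreenbergTwoVariableMainConjectureAnyRootAt ι W K v vbar κ₁ κ₂ γ₁ γ₂ f)
    (h314 : prop314_span_minus_eq_span_bdp_anyRoot) (h422 : prop422_exists_isBDPLFunction_mu_eq_zero)
    (hf : IsNewformOf W f) (hS : GreenbergSetting ι W N K v vbar κ₁ κ₂)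
    (hHeeg : SatisfiesHeegnerHypothesis N K) (hirrK : (W.baseChange K).HasIrreducibleModPGaloisRep p) :
    ∃ (Ω δ : ℂ) (Ωp : (unrIntegers p)ˣ) (LK G : PowerSeries (PowerSeries (PadicComplexInt p))),
      IsKatzMeasure₂ ι v vbar ∅ κ₁ κ₂ γ₁⁻¹ γ₂⁻¹ 1 Ω δ ((Ωp : unrIntegers p) : ℂ_[p]) LK ∧
      IsGreenbergLFunctionAnyRoot₂ ι v vbar κ₁ κ₂ γ₁⁻¹ γ₂⁻¹ f (NumberField.discr K).natAbs
        (NumberField.classNumber K) LK G ∧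
      HasUnitContent (minus G) ∧
      ∀ J : ℤ_[p] →+* PadicComplexInt p,
        (∀ x : ℤ_[p], ((J x : PadicComplexInt p) : ℂ_[p]) = ((x : ℚ_[p]) : ℂ_[p])) →
        (WeierstrassCurve.XGr₂.charIdeal (W.baseChange K) p κ₁ κ₂ vbar γ₁ γ₂).map (toUnr₂ p J) =
          Ideal.span {G} := by
  obtain ⟨Ω, δ, Ωp, LK, G, -, -, hLK, hG, -, hJ⟩ := h
  exact ⟨Ω, δ, Ωp, LK, G, hLK, hG, hasUnitContent_minus_of_prop314AnyRoot_of_prop422 h314 h422 ι W K v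
    vbar κ₁ κ₂ γ₁ γ₂ hf hS hHeeg hirrK hLK hG, hJ⟩

end Consequences

/-! ### (3) BCS Theorem 4.1.3 — "Conjecture 4.1.1 and Conjecture 4.1.2 are equivalent" — as PROVED
edges modulo the typed two-variable equivalence `YanZhu2026.thm47_…AnyRoot_…` -/

section Thm413

variable (ι₁ : integralClosure ℚ ℂ →+* ℂ_[p]) (ι : PadicAlgCl p ≃+* ℂ) (W : WeierstrassCurve ℚ)
  [W.IsElliptic] [W.IsGloballyMinimal] (v vbar : HeightOneSpectrum (𝓞 K)) (κ₁ κ₂ : ZpExtension K p)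
  (γ₁ γ₂ : absoluteGaloisGroup K) [Fact (ZpExtension.IsTopGeneratorPair κ₁ κ₂ γ₁ γ₂)] {N : ℕ}
  [NeZero N] (π : ModularParametrizationData W N) [NeZero (NumberField.discr K).natAbs]

/-- **BCS Thm. 4.1.3, (i) ⟹ (ii) on the characteristic ideals ("before inverting `p`", both
divisibilities): statement 4.1.1 at a datum gives the Greenberg EQUALITY
`ch(X_Gr)·𝒪_{ℂ_p}⟦T₁,T₂⟧ = (L_p^Gr)` for EVERY Katz/Greenberg frame `(LK, G)` of `f_E` and every
compatible `J`** — granted the typed equivalence `thm47_…` (YZ Thm. 4.7 with `S = {1}`, both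
directions; hypotheses: Greenberg standing data, (irr_K), `ι₁` compatible with `ι`).  The printed
"four-term exact sequences coming from Poitou–Tate duality" are inside the named fact.
[cite: BurungaleCastellaSkinner2025, Thm. 4.1.3 and its proof (§4.1, p. 8 of arXiv:2405.00270v2)]
[cite: YanZhu2024MainConjNonCM, Thm. 4.7 with S = {1} (arXiv:2412.20078v4 TeX l.1022–1034, l.1036–1050)] -/
theorem charIdeal_map_eq_span_of_ordinaryAt (h47 : thm47_ord_localised_iff_greenbergAnyRoot_localised)
    (hS : GreenbergSetting ι W N K v vbar κ₁ κ₂) (hirrK : (W.baseChange K).HasIrreducibleModPGaloisRep p)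
    (hι : ∀ z : integralClosure ℚ ℂ, ι₁ z = ((ι.symm (z : ℂ) : PadicAlgCl p) : ℂ_[p]))
    (hord : OrdinaryTwoVariableMainConjectureAt ι₁ W K κ₁ κ₂ γ₁ γ₂ π)
    {Ω δ : ℂ} {Ωp : (unrIntegers p)ˣ} {LK G : PowerSeries (PowerSeries (PadicComplexInt p))}
    (hLK : IsKatzMeasure₂ ι v vbar ∅ κ₁ κ₂ γ₁⁻¹ γ₂⁻¹ 1 Ω δ ((Ωp : unrIntegers p) : ℂ_[p]) LK)
    (hG : IsGreenbergLFunctionAnyRoot₂ ι v vbar κ₁ κ₂ γ₁⁻¹ γ₂⁻¹ π.f (NumberField.discr K).natAbs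
      (NumberField.classNumber K) LK G)
    {J : ℤ_[p] →+* PadicComplexInt p}
    (hJ : ∀ x : ℤ_[p], ((J x : PadicComplexInt p) : ℂ_[p]) = ((x : ℚ_[p]) : ℂ_[p])) :
    (WeierstrassCurve.XGr₂.charIdeal (W.baseChange K) p κ₁ κ₂ vbar γ₁ γ₂).map (toUnr₂ p J) =
      Ideal.span {G} := by
  obtain ⟨F, hF, hc, -, hle, hge⟩ := hord
  obtain ⟨h1, h2⟩ := h47 ι₁ ι W K v vbar κ₁ κ₂ γ₁ γ₂ π hS hirrK hι F hF hc Ω δ Ωp LK G hLK hG J hJ 1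
    one_ne_zero
  have hle' := h1.mp (hle.away 1)
  have hge' := h2.mp (hge.away 1)
  rw [map_one, exists_span_one_pow_mul_le_iff] at hle' hge'
  exact le_antisymm hle' hge'

/-- **BCS Thm. 4.1.3, (ii) ⟹ (i) on the characteristic ideals: statement 4.1.2 at a datum gives BOTH
ORDINARY inclusions `ch(X_ord) ⊂ (L_p^PR)` and `(L_p^PR) ⊂ ch(X_ord)` in `Λ_K` for EVERY type-I frame
`F = 𝓛_p(f_E/K, Σ^{(1)})`** (`IsHidaRankinLFunction ι₁ … π.f F ∧ IsCongruenceIntegral π.f F`,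
`L_p^PR = perrinRiouLFunction W π F`) — granted `thm47_…`, under the Greenberg standing data, (irr_K)
and `ι₁` compatible with `ι`.  (Uses a compatible `J`, which exists: `exists_structureMap_padicInt`.)
[cite: BurungaleCastellaSkinner2025, Thm. 4.1.3 and its proof (§4.1, p. 8 of arXiv:2405.00270v2)]
[cite: YanZhu2024MainConjNonCM, Thm. 4.7 with S = {1} (arXiv:2412.20078v4 TeX l.1022–1034)] -/
theorem ordinary_inclusions_of_greenbergAt (h47 : thm47_ord_localised_iff_greenbergAnyRoot_localised)
    (hS : GreenbergSetting ι W N K v vbar κ₁ κ₂) (hirrK : (W.baseChange K).HasIrreducibleModPGaloisRep p)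
    (hι : ∀ z : integralClosure ℚ ℂ, ι₁ z = ((ι.symm (z : ℂ) : PadicAlgCl p) : ℂ_[p]))
    (hgr : GreenbergTwoVariableMainConjectureAnyRootAt ι W K v vbar κ₁ κ₂ γ₁ γ₂ π.f) {F : CycAntiSeries p}
    (hF : IsHidaRankinLFunction ι₁ W κ₁ κ₂ π.f F) (hc : IsCongruenceIntegral π.f F) :
    IdealLeSpan (WeierstrassCurve.XOrd₂.charIdeal (W.baseChange K) p κ₁ κ₂ γ₁ γ₂)
        (perrinRiouLFunction W π F) ∧
      SpanLeIdeal (perrinRiouLFunction W π F)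
        (WeierstrassCurve.XOrd₂.charIdeal (W.baseChange K) p κ₁ κ₂ γ₁ γ₂) := by
  obtain ⟨Ω, δ, Ωp, LK, G, -, -, hLK, hG, -, hJall⟩ := hgr
  obtain ⟨J, hJ⟩ := exists_structureMap_padicInt (p := p)
  obtain ⟨h1, h2⟩ := h47 ι₁ ι W K v vbar κ₁ κ₂ γ₁ γ₂ π hS hirrK hι F hF hc Ω δ Ωp LK G hLK hG J hJ 1
    one_ne_zero
  have heq := hJall J hJ
  rw [map_one, exists_span_one_pow_mul_le_iff] at h1 h2
  exact ⟨idealLeSpanAway_one_iff.mp (h1.mpr heq.le), spanLeIdealAway_one_iff.mp (h2.mpr heq.ge)⟩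

/-- **BCS Thm. 4.1.3, "Conjecture 4.1.1 ⟹ Conjecture 4.1.2" AT a datum** — granted the typed
equivalence `thm47_…` and the existence of the Greenberg frame `thm39_def311_…`, with the torsion
clause of the Greenberg side supplied as a hypothesis (Thm. 4.7 as typed transports divisibilities,
not torsion-ness; print obtains `X_Gr` torsion from the same four-term sequences — on the Heegner
locus it is part of `thm42_XGr₂_…`).
[cite: BurungaleCastellaSkinner2025, Thm. 4.1.3 ("In particular, Conjecture 4.1.1 and Conjecture 4.1.2 are equivalent", §4.1, p. 8 of arXiv:2405.00270v2)]
[cite: YanZhu2024MainConjNonCM, Thm. 4.7 (arXiv:2412.20078v4 TeX l.1022–1034) with Def. 3.11 / Thm. 3.9–3.10 (frame existence, l.839–878)] -/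
theorem of_ordinaryAt (h47 : thm47_ord_localised_iff_greenbergAnyRoot_localised)
    (h39 : thm39_def311_exists_isGreenbergLFunctionAnyRoot₂) (hS : GreenbergSetting ι W N K v vbar κ₁ κ₂)
    (hirrK : (W.baseChange K).HasIrreducibleModPGaloisRep p)
    (hι : ∀ z : integralClosure ℚ ℂ, ι₁ z = ((ι.symm (z : ℂ) : PadicAlgCl p) : ℂ_[p]))
    (htor : Module.IsTorsion (IwasawaAlgebra₂ p) ((W.baseChange K).XGr₂ p κ₁ κ₂ vbar γ₁ γ₂))
    (hord : OrdinaryTwoVariableMainConjectureAt ι₁ W K κ₁ κ₂ γ₁ γ₂ π) :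
    GreenbergTwoVariableMainConjectureAnyRootAt ι W K v vbar κ₁ κ₂ γ₁ γ₂ π.f := by
  obtain ⟨Ω, δ, Ωp, LK, G, hΩ, hδ, hLK, hG⟩ := h39 ι W K v vbar κ₁ κ₂ γ₁ γ₂ π.isNewformOf hS
  exact ⟨Ω, δ, Ωp, LK, G, hΩ, hδ, hLK, hG, htor, fun J hJ ↦
    charIdeal_map_eq_span_of_ordinaryAt ι₁ ι W v vbar κ₁ κ₂ γ₁ γ₂ π h47 hS hirrK hι hord hLK hG hJ⟩

/-- **BCS Thm. 4.1.3, "Conjecture 4.1.2 ⟹ Conjecture 4.1.1" AT a datum** — granted the typed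
equivalence `thm47_…`, a type-I frame `F` of `f_E` (print: [CGS23, Thm. 1.2.1] — typed as the
hypotheses `IsHidaRankinLFunction … F`, `IsCongruenceIntegral π.f F`), and the torsion clause of the
ordinary side DISCHARGED by the flag-free named fact `YanZhu2026.cor29_XOrd₂_isTorsion` (YZ Cor. 2.9:
`X_ord` is `Λ_K`-torsion at an odd good ordinary split prime under (irr_K), `(N_E, D_K) = 1`).
[cite: BurungaleCastellaSkinner2025, Thm. 4.1.3 ("In particular, Conjecture 4.1.1 and Conjecture 4.1.2 are equivalent", §4.1, p. 8 of arXiv:2405.00270v2)]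
[cite: YanZhu2024MainConjNonCM, Thm. 4.7 (arXiv:2412.20078v4 TeX l.1022–1034) and Cor. 2.9 (l.628–633)] -/
theorem ordinaryAt_of (h47 : thm47_ord_localised_iff_greenbergAnyRoot_localised) (h29 : cor29_XOrd₂_isTorsion)
    (hS : GreenbergSetting ι W N K v vbar κ₁ κ₂) (hirrK : (W.baseChange K).HasIrreducibleModPGaloisRep p)
    (hι : ∀ z : integralClosure ℚ ℂ, ι₁ z = ((ι.symm (z : ℂ) : PadicAlgCl p) : ℂ_[p]))
    {F : CycAntiSeries p} (hF : IsHidaRankinLFunction ι₁ W κ₁ κ₂ π.f F) (hc : IsCongruenceIntegral π.f F)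
    (hgr : GreenbergTwoVariableMainConjectureAnyRootAt ι W K v vbar κ₁ κ₂ γ₁ γ₂ π.f) :
    OrdinaryTwoVariableMainConjectureAt ι₁ W K κ₁ κ₂ γ₁ γ₂ π := by
  have hN : (N : ℤ) = W.conductorNorm ℤ := hS.level
  have htor : Module.IsTorsion (IwasawaAlgebra₂ p) ((W.baseChange K).XOrd₂ p κ₁ κ₂ γ₁ γ₂) :=
    h29 W K κ₁ κ₂ γ₁ γ₂ hS.three_le hS.goodOrd hS.isImaginaryQuadratic hS.split (hN ▸ hS.coprime) hirrK
  obtain ⟨hle, hge⟩ := ordinary_inclusions_of_greenbergAt ι₁ ι W v vbar κ₁ κ₂ γ₁ γ₂ π h47 hS hirrK hι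
    hgr hF hc
  exact ⟨F, hF, hc, htor, hle, hge⟩

end Thm413

/-! ### (4) The sentence specialises to the statement at a datum — PROVED -/

/-- Granted the printed sentence, the statement holds at every datum on its locus (print's hypotheses
and (irr_K)). [cite: BurungaleCastellaSkinner2025, statement 4.1.2 (§4.1, p. 8 of arXiv:2405.00270v2)] -/
theorem at_of_statement (h : bcs2025_statement_4_1_2_anyRoot) (ι : PadicAlgCl p ≃+* ℂ) (W : WeierstrassCurve ℚ)
    [W.IsElliptic] [W.IsGloballyMinimal] (v vbar : HeightOneSpectrum (𝓞 K)) (κ₁ κ₂ : ZpExtension K p)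
    (γ₁ γ₂ : absoluteGaloisGroup K) [Fact (ZpExtension.IsTopGeneratorPair κ₁ κ₂ γ₁ γ₂)] {N : ℕ}
    [NeZero N] {f : CuspForm (Gamma0 N) 2} (hf : IsNewformOf W f) [NeZero (NumberField.discr K).natAbs]
    (hN : (N : ℤ) = W.conductorNorm ℤ) (hp : 3 ≤ p) (hgood : Good W p) (hK : IsImaginaryQuadratic K)
    (hspl : ((Ideal.span {(p : ℤ)}).primesOver (𝓞 K)).ncard = 2) (hv : ((p : ℕ) : 𝓞 K) ∈ v.asIdeal)
    (hvbar : ((p : ℕ) : 𝓞 K) ∈ vbar.asIdeal) (hne : vbar ≠ v)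
    (hι : ∀ (w : InfinitePlace K) (k : 𝓞 K), k ∈ v.asIdeal ↔ ‖ι.symm (w.embedding (k : K))‖ < 1)
    (hcyc : κ₁.IsCyclotomic) (hanti : κ₂.IsAnticyclotomic)
    (hirrK : (W.baseChange K).HasIrreducibleModPGaloisRep p) :
    GreenbergTwoVariableMainConjectureAnyRootAt ι W K v vbar κ₁ κ₂ γ₁ γ₂ f :=
  h ι W K v vbar κ₁ κ₂ γ₁ γ₂ hf hN hp hgood hK hspl hv hvbar hne hι hcyc hanti hirrK

/-- **The [YZ26] standing data lie on the sentence's locus**: granted the printed sentence, the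
statement holds at every datum carrying `YanZhu2026.GreenbergSetting` (good ORDINARY `p > 2` split in
`K`, `v` induced by `ι`, `(N, D_K) = 1`, (disc), (cyc, anti)) and (irr_K) — the locus of the Yan–Zhu named facts
(and of the superseded v1 file).
[cite: BurungaleCastellaSkinner2025, statement 4.1.2 (§4.1, p. 8 of arXiv:2405.00270v2)]
[cite: YanZhu2024MainConjNonCM, §2.1/§3.5 standing data (arXiv:2412.20078v4 TeX l.909–915)] -/
theorem at_of_statement_of_greenbergSetting (h : bcs2025_statement_4_1_2_anyRoot) (ι : PadicAlgCl p ≃+* ℂ)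
    (W : WeierstrassCurve ℚ) [W.IsElliptic] [W.IsGloballyMinimal] (v vbar : HeightOneSpectrum (𝓞 K))
    (κ₁ κ₂ : ZpExtension K p) (γ₁ γ₂ : absoluteGaloisGroup K)
    [Fact (ZpExtension.IsTopGeneratorPair κ₁ κ₂ γ₁ γ₂)] {N : ℕ} [NeZero N] {f : CuspForm (Gamma0 N) 2}
    (hf : IsNewformOf W f) [NeZero (NumberField.discr K).natAbs] (hS : GreenbergSetting ι W N K v vbar κ₁ κ₂)
    (hirrK : (W.baseChange K).HasIrreducibleModPGaloisRep p) :
    GreenbergTwoVariableMainConjectureAnyRootAt ι W K v vbar κ₁ κ₂ γ₁ γ₂ f :=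
  h ι W K v vbar κ₁ κ₂ γ₁ γ₂ hf hS.level hS.three_le hS.goodOrd.1 hS.isImaginaryQuadratic hS.split
    hS.mem_v hS.mem_vbar hS.vbar_ne hS.compat hS.cyclotomic hS.anticyclotomic hirrK

end GreenbergAnyRoot

end Summit.BirchSwinnertonDyer.Rank1Residual.TwoVariableIMC

end
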